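import Literature.LinearAlgebra.QuadraticForm.MaslovIndexQuadraticSpace
import Literature.LinearAlgebra.QuadraticForm.QuadraticSubquotient
import Literature.LinearAlgebra.QuadraticForm.KashiwaraWittIndex
import HarnessLib

/-!
# The Maslov index as a quadratic space: Kashiwara comparison and the chain condition
# ([Thomas2006, Prop. 11 and Prop. 6])

Topic `LinearAlgebra/QuadraticForm`; namespace `Literature.LinearAlgebra.QuadraticForm`. KERNEL mathematics only
(definitions with bodies + theorems; no named fact, no `axiom`, no `sorry`). Sequel of
`MaslovIndexQuadraticSpace.lean` (`polygonSpace`, `polygonForm`, `polygonWittIndex` = [Thomas2006] `K_{1,…,n}`,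
`q_{1,…,n}`, `τ_{1,…,n}`) using `QuadraticSubquotient.lean` ([Thomas2006, Lemma 1]).

* §1 the vertex-peeling formula `q_{N+1}(u, u') = B(Σ_{i≥1} u_i, u'_0) + q_N(tail u, tail u')` for the explicit
  form (eq. explicit) — the computational engine of this file.
* §2 **[Thomas2006, Proposition 11] for `n = 3`: `τ_{1,2,3} = τ_K(l₁, l₂, l₃)`** (Kashiwara's index, the tree's
  `kashiwaraWittIndex`): "**Lemma 12.** `I = l₁ ⊂ T_K` is an isotropic subspace;
  `I^⊥ = {(v₁, v₂, v₃) with v₂ − v₃ ∈ l₁}`. **Lemma 13.** The map `(v₁, v₂, v₃) ↦ (v₂ − v₃, −v₂, v₃)` defines an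
  isometric surjection `I^⊥ → K_{1,2,3}`." (`polygonWittIndex_three_eq_kashiwaraWittIndex`; hypotheses: `B`
  alternating, `l₁` Lagrangian).
* §3 **[Thomas2006, Proposition 6] (chain condition) for the chord `(l₁, l₃)`**:
  `τ(l₁, l₂, …, lₙ) = τ(l₁, l₂, l₃) + τ(l₁, l₃, …, lₙ)`, through the printed route: the gluing map
  `s : K_{1,2,3} ⊕ K_{1,3,…,n} → K_{1,…,n}` is an isometry (**Lemma 7**), its image is `(image s∘r)^⊥` for the
  isotropic line(s) `s∘r(l₁ ∩ l₃)` (**Lemma 8**), hence `T_{1,2,3} ⊕ T_{1,3,…,n}` is a quadratic subquotient of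
  `T_{1,…,n}` and Lemma 1 applies (`polygonWittIndex_chain₃`; hypotheses: `B` alternating non-degenerate, `l₁, l₃`
  Lagrangian, characteristic `≠ 2`). With §2: `τ(l₁, …, lₙ) = τ_K(l₁, l₂, l₃) + τ(l₁, l₃, …, lₙ)`, and by
  induction the fan formula `τ(l₁, …, lₙ) = Σ_{j=2}^{n−1} τ_K(l₁, l_j, l_{j+1})` ((Kash:cocycle2) of [Thomas2006,
  §7]; [LionVergne1980, 1.5.12]) for Lagrangians `l_i` (`polygonWittIndex_eq_sum_kashiwaraWittIndex`).

Indexing: families are `ℓ : Fin (m + 3) → Submodule K V` (vertices `0, 1, 2, …`); the triangle is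
`![ℓ 0, ℓ 1, ℓ 2]` and the complementary polygon is `ℓ ∘ Fin.succAbove 1` (vertex `1` removed).

## References

* [Thomas2006] T. Thomas, *The Maslov index as a quadratic space*, Math. Res. Lett. 13 (2006) 985–999
  (arXiv:math/0505561): §1.3.2 Lemma 1, §5 Proposition 6 with Lemmas 7–8, §7 Proposition 11 with Lemmas 12–13.
* [LionVergne1980] G. Lion, M. Vergne, *The Weil representation, Maslov index and Theta series*, PM 6 (1980),
  §1.5.8, §1.5.12; Appendix A.7 d).
-/

set_option autoImplicit false

noncomputable section

open QuadraticMap Module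

namespace Literature.LinearAlgebra.QuadraticForm

universe u v w

variable {K : Type u} [Field K]
variable {V : Type v} [AddCommGroup V] [Module K V]

/-! ## §0 Lemma 1 in push-forward form -/

/-- **[Thomas2006, Lemma 1], push-forward form**: if `s : S → E` is linear with `Q_E ∘ s = Q_S` and
`range s = I^⊥` for a totally isotropic `I`, then `{Q_S} = {Q_E}` (indeed `Q_S ∼ Q_E|_{range s} = Q_E|_{I^⊥} ∼ Q_E`).
[cite: Thomas2006, §1.3.2 Lemma 1] -/
theorem wittClass_eq_of_range_eq_orthogonal [NeZero (2 : K)] {E : Type v} [AddCommGroup E] [Module K E]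
    [FiniteDimensional K E] {S : Type w} [AddCommGroup S] [Module K S] [FiniteDimensional K S]
    (Q : QuadraticForm K E) {I : Submodule K E} (hI : IsTotallyIsotropic Q I) (QS : QuadraticForm K S)
    (s : S →ₗ[K] E) (hs : LinearMap.range s = (polarForm Q).orthogonal I) (h : QS = Q.comp s) :
    wittClass QS = wittClass Q := by
  have hmem : ∀ x, s x ∈ (polarForm Q).orthogonal I := fun x => by rw [← hs]; exact LinearMap.mem_range_self s x
  set s' : S →ₗ[K] (polarForm Q).orthogonal I := LinearMap.codRestrict _ s hmem with hs'
  have hsurj : Function.Surjective s' := by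
    intro y
    have hy : (y : E) ∈ LinearMap.range s := by rw [hs]; exact y.2
    obtain ⟨x, hx⟩ := LinearMap.mem_range.1 hy
    exact ⟨x, Subtype.ext hx⟩
  have hQS : QS = (Q.restrict ((polarForm Q).orthogonal I)).comp s' := by
    rw [h]
    refine QuadraticMap.ext fun x => ?_
    rfl
  rw [hQS, wittClass_comp_of_surjective _ s' hsurj, wittClass_restrict_orthogonal Q hI]

/-! ## §1 Peeling off the vertex `0` -/

section Peel

variable (B : LinearMap.BilinForm K V)

/-- **`q_{N+1}(u, u') = B(Σ_{i≥1} u_i, u'_0) + q_N(tail u, tail u')`** for the explicit form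
`q(u, u') = Σ_{j<i} B(u_i, u'_j)` (the pairs with `j = 0`, then the pairs inside `{1, …, N}`).
[cite: Thomas2006, §2.2.2 Remark 2 (eq. explicit)] -/
theorem polygonBilin_succ (N : ℕ) (u u' : Fin (N + 1) → V) :
    polygonBilin B (N + 1) u u' = B (∑ i : Fin N, u i.succ) (u' 0) + polygonBilin B N (Fin.tail u) (Fin.tail u') := by
  rw [polygonBilin_apply, polygonBilin_apply, Fin.sum_univ_succ]
  have h0 : (∑ j : Fin (N + 1), if j < (0 : Fin (N + 1)) then B (u 0) (u' j) else 0) = 0 :=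
    Finset.sum_eq_zero fun j _ => by rw [if_neg (Fin.not_lt_zero j)]
  rw [h0, zero_add, map_sum, LinearMap.sum_apply, ← Finset.sum_add_distrib]
  refine Finset.sum_congr rfl fun i _ => ?_
  rw [Fin.sum_univ_succ, if_pos (Fin.succ_pos i)]
  simp only [Fin.succ_lt_succ_iff, Fin.tail]

/-- `q_0 = 0`. [cite: Thomas2006, §2.2.2] -/
theorem polygonBilin_zero (u u' : Fin 0 → V) : polygonBilin B 0 u u' = 0 := by
  rw [polygonBilin_apply]
  exact Finset.sum_eq_zero fun i _ => Fin.elim0 i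

/-- `q_1 = 0`. [cite: Thomas2006, §2.2.2] -/
theorem polygonBilin_one (u u' : Fin 1 → V) : polygonBilin B 1 u u' = 0 := by
  rw [polygonBilin_succ, polygonBilin_zero, add_zero, Finset.univ_eq_empty, Finset.sum_empty, map_zero,
    LinearMap.zero_apply]

/-- `q_2(u, u') = B(u_1, u'_0)`. [cite: Thomas2006, §2.2.2] -/
theorem polygonBilin_two (u u' : Fin 2 → V) : polygonBilin B 2 u u' = B (u 1) (u' 0) := by
  rw [polygonBilin_succ, polygonBilin_one, add_zero, Fin.sum_univ_one]
  rfl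

/-- `q_3(u, u') = B(u_1 + u_2, u'_0) + B(u_2, u'_1)`. [cite: Thomas2006, §2.2.2] -/
theorem polygonBilin_three (u u' : Fin 3 → V) :
    polygonBilin B 3 u u' = B (u 1 + u 2) (u' 0) + B (u 2) (u' 1) := by
  rw [polygonBilin_succ, polygonBilin_two, Fin.sum_univ_two]
  rfl

end Peel

/-! ## §2 [Thomas2006, Proposition 11]: `τ_{1,2,3}` is Kashiwara's index -/

section Three

variable (B : LinearMap.BilinForm K V) (ℓ₁ ℓ₂ ℓ₃ : Submodule K V)

/-- the line `I = l₁ ⊂ T_K = l₁ ⊕ l₂ ⊕ l₃` of [Thomas2006, Lemma 12]. [cite: Thomas2006, §7 Lemma 12] -/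
def kashiwaraLineOne : Submodule K (ℓ₁ × ℓ₂ × ℓ₃) :=
  LinearMap.range (LinearMap.inl K ℓ₁ (ℓ₂ × ℓ₃))

/-- membership in `I`. [cite: Thomas2006, §7 Lemma 12] -/
theorem mem_kashiwaraLineOne_iff (p : ℓ₁ × ℓ₂ × ℓ₃) : p ∈ kashiwaraLineOne ℓ₁ ℓ₂ ℓ₃ ↔ p.2 = 0 := by
  constructor
  · rintro ⟨x, rfl⟩; rfl
  · intro h; exact ⟨p.1, Prod.ext rfl h.symm⟩

/-- **[Thomas2006, Lemma 12]: `I = l₁` is isotropic for Kashiwara's form** (`Q_K(x, 0, 0) = 0`).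
[cite: Thomas2006, §7 Lemma 12] -/
theorem isTotallyIsotropic_kashiwaraLineOne :
    IsTotallyIsotropic (kashiwaraForm B ℓ₁ ℓ₂ ℓ₃) (kashiwaraLineOne ℓ₁ ℓ₂ ℓ₃) := by
  rintro p ⟨x, rfl⟩
  rw [kashiwaraForm_apply]
  simp only [LinearMap.inl_apply, Prod.snd_zero, Prod.fst_zero, Submodule.coe_zero, map_zero,
    LinearMap.zero_apply, add_zero]

/-- the polar form of `Q_K` against `(x, 0, 0)`: `B(x, v₂) + B(v₃, x)`. [cite: Thomas2006, §7 Lemma 12] -/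
theorem polar_kashiwaraForm_inl (x : ℓ₁) (p : ℓ₁ × ℓ₂ × ℓ₃) :
    polar (kashiwaraForm B ℓ₁ ℓ₂ ℓ₃) (LinearMap.inl K ℓ₁ (ℓ₂ × ℓ₃) x) p =
      B (x : V) (p.2.1 : V) + B (p.2.2 : V) (x : V) := by
  rw [kashiwaraForm, LinearMap.BilinMap.polar_toQuadraticMap, kashiwaraBilin_apply, kashiwaraBilin_apply]
  simp only [LinearMap.inl_apply, Prod.snd_zero, Prod.fst_zero, Submodule.coe_zero, map_zero,
    LinearMap.zero_apply, add_zero, zero_add]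

variable {B ℓ₁ ℓ₂ ℓ₃}

/-- **[Thomas2006, Lemma 12]: `I^⊥ = {(v₁, v₂, v₃) : v₂ − v₃ ∈ l₁}`** (`B` alternating, `l₁ = l₁^⊥`).
[cite: Thomas2006, §7 Lemma 12] -/
theorem mem_orthogonal_kashiwaraLineOne_iff (hB : B.IsAlt) (h₁ : B.orthogonal ℓ₁ = ℓ₁) (p : ℓ₁ × ℓ₂ × ℓ₃) :
    p ∈ (polarForm (kashiwaraForm B ℓ₁ ℓ₂ ℓ₃)).orthogonal (kashiwaraLineOne ℓ₁ ℓ₂ ℓ₃) ↔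
      (p.2.1 : V) - (p.2.2 : V) ∈ ℓ₁ := by
  have key := SetLike.ext_iff.1 h₁
  rw [LinearMap.BilinForm.mem_orthogonal_iff]
  constructor
  · intro h
    refine (key _).1 (LinearMap.BilinForm.mem_orthogonal_iff.2 fun x hx => ?_)
    have e : polar (kashiwaraForm B ℓ₁ ℓ₂ ℓ₃) (LinearMap.inl K ℓ₁ (ℓ₂ × ℓ₃) ⟨x, hx⟩) p = 0 :=
      h _ ⟨⟨x, hx⟩, rfl⟩
    rw [polar_kashiwaraForm_inl] at e
    change B x (p.2.1 : V) + B (p.2.2 : V) x = 0 at e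
    change B x ((p.2.1 : V) - (p.2.2 : V)) = 0
    rw [← LinearMap.IsAlt.neg hB x (p.2.2 : V), ← sub_eq_add_neg, ← map_sub] at e
    exact e
  · rintro h _ ⟨x, rfl⟩
    change polar (kashiwaraForm B ℓ₁ ℓ₂ ℓ₃) (LinearMap.inl K ℓ₁ (ℓ₂ × ℓ₃) x) p = 0
    rw [polar_kashiwaraForm_inl, ← LinearMap.IsAlt.neg hB (x : V) (p.2.2 : V), ← sub_eq_add_neg, ← map_sub]
    exact LinearMap.BilinForm.mem_orthogonal_iff.1 ((key _).2 h) x x.2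

/-- **[Thomas2006, Lemma 13]: the map `(v₁, v₂, v₃) ↦ (v₂ − v₃, −v₂, v₃)`, `I^⊥ → K_{1,2,3}`** (linear).
[cite: Thomas2006, §7 Lemma 13] -/
def kashiwaraToPolygon (hB : B.IsAlt) (h₁ : B.orthogonal ℓ₁ = ℓ₁) :
    (polarForm (kashiwaraForm B ℓ₁ ℓ₂ ℓ₃)).orthogonal (kashiwaraLineOne ℓ₁ ℓ₂ ℓ₃) →ₗ[K]
      polygonSpace ![ℓ₁, ℓ₂, ℓ₃] where
  toFun p := ⟨![((p : ℓ₁ × ℓ₂ × ℓ₃).2.1 : V) - ((p : ℓ₁ × ℓ₂ × ℓ₃).2.2 : V),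
      -((p : ℓ₁ × ℓ₂ × ℓ₃).2.1 : V), ((p : ℓ₁ × ℓ₂ × ℓ₃).2.2 : V)], by
    rw [mem_polygonSpace_iff]
    refine ⟨fun i => ?_, ?_⟩
    · fin_cases i
      · simpa using (mem_orthogonal_kashiwaraLineOne_iff hB h₁ _).1 p.2
      · simp
      · simp
    · rw [Fin.sum_univ_three]
      simp only [Matrix.cons_val_zero, Matrix.cons_val_one, Matrix.cons_val_two, Matrix.head_cons,
        Matrix.tail_cons]
      abel⟩
  map_add' p q := by
    ext i
    fin_cases i <;> simp only [Submodule.coe_add, Prod.fst_add, Prod.snd_add, Pi.add_apply] <;> simp <;> abel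
  map_smul' c p := by
    ext i
    fin_cases i <;> simp only [Submodule.coe_smul, Prod.smul_fst, Prod.smul_snd, Pi.smul_apply,
      RingHom.id_apply] <;> simp [smul_sub]

/-- components of the map of Lemma 13. [cite: Thomas2006, §7 Lemma 13] -/
theorem coe_kashiwaraToPolygon (hB : B.IsAlt) (h₁ : B.orthogonal ℓ₁ = ℓ₁)
    (p : (polarForm (kashiwaraForm B ℓ₁ ℓ₂ ℓ₃)).orthogonal (kashiwaraLineOne ℓ₁ ℓ₂ ℓ₃)) :
    (kashiwaraToPolygon hB h₁ p : Fin 3 → V) =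
      ![((p : ℓ₁ × ℓ₂ × ℓ₃).2.1 : V) - ((p : ℓ₁ × ℓ₂ × ℓ₃).2.2 : V), -((p : ℓ₁ × ℓ₂ × ℓ₃).2.1 : V),
        ((p : ℓ₁ × ℓ₂ × ℓ₃).2.2 : V)] := rfl

/-- **[Thomas2006, Lemma 13]: the map is surjective** (`(0, −w₂, w₃) ↦ (w₁, w₂, w₃)` for `w ∈ K_{1,2,3}`).
[cite: Thomas2006, §7 Lemma 13] -/
theorem kashiwaraToPolygon_surjective (hB : B.IsAlt) (h₁ : B.orthogonal ℓ₁ = ℓ₁) :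
    Function.Surjective (kashiwaraToPolygon (ℓ₂ := ℓ₂) (ℓ₃ := ℓ₃) hB h₁) := by
  intro w
  have hw := (mem_polygonSpace_iff _ (w : Fin 3 → V)).1 w.2
  have hw0 : (w : Fin 3 → V) 0 ∈ ℓ₁ := by simpa using hw.1 0
  have hw1 : (w : Fin 3 → V) 1 ∈ ℓ₂ := by simpa using hw.1 1
  have hw2 : (w : Fin 3 → V) 2 ∈ ℓ₃ := by simpa using hw.1 2
  have hsum : (w : Fin 3 → V) 0 + (w : Fin 3 → V) 1 + (w : Fin 3 → V) 2 = 0 := by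
    rw [← Fin.sum_univ_three]; exact hw.2
  set p : ℓ₁ × ℓ₂ × ℓ₃ := (0, ⟨-(w : Fin 3 → V) 1, ℓ₂.neg_mem hw1⟩, ⟨(w : Fin 3 → V) 2, hw2⟩) with hp
  have e : -(w : Fin 3 → V) 1 - (w : Fin 3 → V) 2 = (w : Fin 3 → V) 0 := by
    rw [add_assoc] at hsum
    rw [eq_neg_of_add_eq_zero_left hsum]
    abel
  have hp' : p ∈ (polarForm (kashiwaraForm B ℓ₁ ℓ₂ ℓ₃)).orthogonal (kashiwaraLineOne ℓ₁ ℓ₂ ℓ₃) := by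
    rw [mem_orthogonal_kashiwaraLineOne_iff hB h₁]
    change -(w : Fin 3 → V) 1 - (w : Fin 3 → V) 2 ∈ ℓ₁
    rw [e]; exact hw0
  refine ⟨⟨p, hp'⟩, Subtype.ext ?_⟩
  rw [coe_kashiwaraToPolygon]
  ext i
  fin_cases i
  · simpa using e
  · simp [hp]
  · simp [hp]

/-- **[Thomas2006, Lemma 13]: the map is isometric**, `Q_{1,2,3}(v₂ − v₃, −v₂, v₃) = B(v₂, v₃) = Q_K(v₁, v₂, v₃)`
on `I^⊥` (`B` alternating, `l₁` Lagrangian: `B(v₁, v₂ − v₃) = 0`). [cite: Thomas2006, §7 Lemma 13] -/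
theorem kashiwaraForm_restrict_eq_comp (hB : B.IsAlt) (h₁ : B.orthogonal ℓ₁ = ℓ₁) :
    (kashiwaraForm B ℓ₁ ℓ₂ ℓ₃).restrict
        ((polarForm (kashiwaraForm B ℓ₁ ℓ₂ ℓ₃)).orthogonal (kashiwaraLineOne ℓ₁ ℓ₂ ℓ₃)) =
      (polygonForm B ![ℓ₁, ℓ₂, ℓ₃]).comp (kashiwaraToPolygon hB h₁) := by
  refine QuadraticMap.ext fun p => ?_
  rw [QuadraticMap.restrict_apply, QuadraticMap.comp_apply, polygonForm, QuadraticMap.comp_apply,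
    LinearMap.BilinMap.toQuadraticMap_apply, Submodule.coe_subtype, coe_kashiwaraToPolygon, polygonBilin_three,
    kashiwaraForm_apply]
  simp only [Matrix.cons_val_zero, Matrix.cons_val_one, Matrix.cons_val_two, Matrix.head_cons, Matrix.tail_cons]
  -- `v₁ ∈ l₁`, `v₂ - v₃ ∈ l₁`, `l₁` isotropic
  have hiso : B ((p : ℓ₁ × ℓ₂ × ℓ₃).1 : V) ((p : ℓ₁ × ℓ₂ × ℓ₃).2.1 - (p : ℓ₁ × ℓ₂ × ℓ₃).2.2 : V) = 0 := by
    have hm := (SetLike.ext_iff.1 h₁ _).2 ((mem_orthogonal_kashiwaraLineOne_iff hB h₁ _).1 p.2)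
    exact LinearMap.BilinForm.mem_orthogonal_iff.1 hm _ (p : ℓ₁ × ℓ₂ × ℓ₃).1.2
  rw [map_sub] at hiso
  have a₁ := LinearMap.IsAlt.neg hB ((p : ℓ₁ × ℓ₂ × ℓ₃).2.2 : V) ((p : ℓ₁ × ℓ₂ × ℓ₃).1 : V)
  have a₂ := LinearMap.IsAlt.neg hB ((p : ℓ₁ × ℓ₂ × ℓ₃).2.2 : V) ((p : ℓ₁ × ℓ₂ × ℓ₃).2.1 : V)
  have s₁ := hB ((p : ℓ₁ × ℓ₂ × ℓ₃).2.1 : V)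
  have s₂ := hB ((p : ℓ₁ × ℓ₂ × ℓ₃).2.2 : V)
  simp only [map_add, map_neg, map_sub, LinearMap.add_apply, LinearMap.neg_apply] at s₁ s₂ ⊢
  linear_combination hiso - a₁ + s₁ + s₂

variable [NeZero (2 : K)] [FiniteDimensional K V]

/-- **[Thomas2006, Proposition 11] (`n = 3`): `τ_{1,2,3} = τ_K(l₁, l₂, l₃)`** — the Maslov index of the
quadratic space `(T_{1,2,3}, q_{1,2,3})` is Kashiwara's Witt-valued index (the tree's `kashiwaraWittIndex`,
[LionVergne1980, A.6]); `B` alternating, `l₁` Lagrangian, characteristic `≠ 2`.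
[cite: Thomas2006, §7 Proposition 11 (Lemmas 12–13)] -/
theorem polygonWittIndex_three_eq_kashiwaraWittIndex (hB : B.IsAlt) (h₁ : B.orthogonal ℓ₁ = ℓ₁) :
    polygonWittIndex B ![ℓ₁, ℓ₂, ℓ₃] = kashiwaraWittIndex B ℓ₁ ℓ₂ ℓ₃ :=
  wittClass_eq_of_subquotient (kashiwaraForm B ℓ₁ ℓ₂ ℓ₃) (isTotallyIsotropic_kashiwaraLineOne B ℓ₁ ℓ₂ ℓ₃)
    (polygonForm B ![ℓ₁, ℓ₂, ℓ₃]) (kashiwaraToPolygon hB h₁) (kashiwaraToPolygon_surjective hB h₁)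
    (kashiwaraForm_restrict_eq_comp hB h₁)

end Three

/-! ## §3 [Thomas2006, Proposition 6]: the chain condition for the chord `(l₁, l₃)` -/

section Chain

variable (B : LinearMap.BilinForm K V) {m : ℕ} (ℓ : Fin (m + 3) → Submodule K V)

/-- `Q(z) = q(z, z)` on `K_{1,…,n}` (unfolding of `polygonForm` through `polygonBilin`). [cite: Thomas2006, §2.2.2] -/
theorem polygonForm_eq_polygonBilin {n : ℕ} (ℓ' : Fin n → Submodule K V) (z : polygonSpace ℓ') :
    polygonForm B ℓ' z = polygonBilin B n (z : Fin n → V) (z : Fin n → V) := by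
  rw [polygonForm, QuadraticMap.comp_apply, LinearMap.BilinMap.toQuadraticMap_apply, Submodule.coe_subtype]

/-- **the gluing map `s` of [Thomas2006, Prop. 6]** on ambient families ("the identity on each summand"):
`(v, w) ↦ (v₀ + w₀, v₁, v₂ + w₁, w₂, w₃, …)` for `v` indexed by the triangle `(0, 1, 2)` and `w` by the polygon
`(0, 2, 3, …, m+2)` (vertex `1` removed). [cite: Thomas2006, §5 Proposition 6 (the map `s`)] -/
def chainGlue : ((Fin 3 → V) × (Fin (m + 2) → V)) →ₗ[K] (Fin (m + 3) → V) where
  toFun p := (Fin.cons (p.1 0 + p.2 0)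
    (Fin.cons (p.1 1) (Fin.cons (p.1 2 + p.2 1) (fun k : Fin m => p.2 k.succ.succ) : Fin (m + 1) → V) :
      Fin (m + 2) → V) : Fin (m + 3) → V)
  map_add' p q := by
    ext i
    refine Fin.cases ?_ (fun i => ?_) i
    · simp only [Prod.fst_add, Prod.snd_add, Pi.add_apply, Fin.cons_zero, add_add_add_comm]
    refine Fin.cases ?_ (fun i => ?_) i
    · simp only [Prod.fst_add, Prod.snd_add, Pi.add_apply, Fin.cons_succ, Fin.cons_zero]
    refine Fin.cases ?_ (fun i => ?_) i
    · simp only [Prod.fst_add, Prod.snd_add, Pi.add_apply, Fin.cons_succ, Fin.cons_zero, add_add_add_comm]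
    · simp only [Prod.fst_add, Prod.snd_add, Pi.add_apply, Fin.cons_succ]
  map_smul' c p := by
    ext i
    refine Fin.cases ?_ (fun i => ?_) i
    · simp only [Prod.smul_fst, Prod.smul_snd, Pi.smul_apply, Fin.cons_zero, smul_add, RingHom.id_apply]
    refine Fin.cases ?_ (fun i => ?_) i
    · simp only [Prod.smul_fst, Prod.smul_snd, Pi.smul_apply, Fin.cons_succ, Fin.cons_zero, RingHom.id_apply]
    refine Fin.cases ?_ (fun i => ?_) i
    · simp only [Prod.smul_fst, Prod.smul_snd, Pi.smul_apply, Fin.cons_succ, Fin.cons_zero, smul_add,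
        RingHom.id_apply]
    · simp only [Prod.smul_fst, Prod.smul_snd, Pi.smul_apply, Fin.cons_succ, RingHom.id_apply]

/-- value at the vertex `0`. [cite: Thomas2006, §5 Proposition 6] -/
@[simp] theorem chainGlue_zero (p : (Fin 3 → V) × (Fin (m + 2) → V)) : chainGlue (K := K) p 0 = p.1 0 + p.2 0 := rfl

/-- the tail (vertices `1, 2, …`). [cite: Thomas2006, §5 Proposition 6] -/
theorem tail_chainGlue (p : (Fin 3 → V) × (Fin (m + 2) → V)) :
    Fin.tail (chainGlue (K := K) p) =
      (Fin.cons (p.1 1) (Fin.cons (p.1 2 + p.2 1) (fun k : Fin m => p.2 k.succ.succ) : Fin (m + 1) → V) :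
        Fin (m + 2) → V) := rfl

/-- value at the vertex `1`. [cite: Thomas2006, §5 Proposition 6] -/
@[simp] theorem chainGlue_one (p : (Fin 3 → V) × (Fin (m + 2) → V)) : chainGlue (K := K) p 1 = p.1 1 := by
  rw [← Fin.succ_zero_eq_one']
  rfl

/-- value at the vertex `2`. [cite: Thomas2006, §5 Proposition 6] -/
@[simp] theorem chainGlue_two (p : (Fin 3 → V) × (Fin (m + 2) → V)) :
    chainGlue (K := K) p 2 = p.1 2 + p.2 1 := by
  rw [← Fin.succ_one_eq_two', ← Fin.succ_zero_eq_one']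
  rfl

/-- values at the vertices `3, 4, …`. [cite: Thomas2006, §5 Proposition 6] -/
@[simp] theorem chainGlue_succ_succ_succ (p : (Fin 3 → V) × (Fin (m + 2) → V)) (k : Fin m) :
    chainGlue (K := K) p k.succ.succ.succ = p.2 k.succ.succ := rfl

variable {ℓ}

/-- the components and the sum of a member of the triangle space `K(ℓ₀, ℓ₁, ℓ₂)`. [cite: Thomas2006, §2.2.1] -/
theorem polygonSpace.mem_three (v : polygonSpace ![ℓ 0, ℓ 1, ℓ 2]) :
    (v : Fin 3 → V) 0 ∈ ℓ 0 ∧ (v : Fin 3 → V) 1 ∈ ℓ 1 ∧ (v : Fin 3 → V) 2 ∈ ℓ 2 ∧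
      (v : Fin 3 → V) 0 + (v : Fin 3 → V) 1 + (v : Fin 3 → V) 2 = 0 := by
  have h := (mem_polygonSpace_iff _ (v : Fin 3 → V)).1 v.2
  refine ⟨by simpa using h.1 0, by simpa using h.1 1, by simpa using h.1 2, ?_⟩
  rw [← Fin.sum_univ_three]
  exact h.2

/-- the components and the sum of a member of `K(ℓ₀, ℓ₂, ℓ₃, …)` (vertex `1` removed). [cite: Thomas2006, §2.2.1] -/
theorem polygonSpace.mem_succAbove_one (w : polygonSpace (ℓ ∘ Fin.succAbove (1 : Fin (m + 3)))) :
    (w : Fin (m + 2) → V) 0 ∈ ℓ 0 ∧ (w : Fin (m + 2) → V) 1 ∈ ℓ 2 ∧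
      (∀ k : Fin m, (w : Fin (m + 2) → V) k.succ.succ ∈ ℓ k.succ.succ.succ) ∧
      (w : Fin (m + 2) → V) 0 + ((w : Fin (m + 2) → V) 1 + ∑ k : Fin m, (w : Fin (m + 2) → V) k.succ.succ) = 0 := by
  have h := (mem_polygonSpace_iff _ (w : Fin (m + 2) → V)).1 w.2
  refine ⟨?_, ?_, fun k => ?_, ?_⟩
  · have e := h.1 0
    rwa [Function.comp_apply, Fin.one_succAbove_zero] at e
  · have e := h.1 (Fin.succ 0)
    rw [Function.comp_apply, Fin.one_succAbove_succ, Fin.succ_zero_eq_one', Fin.succ_one_eq_two'] at e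
    exact e
  · have e := h.1 k.succ.succ
    rwa [Function.comp_apply, Fin.one_succAbove_succ] at e
  · have e := h.2
    rw [Fin.sum_univ_succ, Fin.sum_univ_succ, Fin.succ_zero_eq_one'] at e
    exact e

variable (ℓ)

/-- `s` maps `K_{1,2,3} ⊕ K_{1,3,…,n}` into `K_{1,…,n}`. [cite: Thomas2006, §5 Proposition 6] -/
theorem chainGlue_mem (v : polygonSpace ![ℓ 0, ℓ 1, ℓ 2]) (w : polygonSpace (ℓ ∘ Fin.succAbove (1 : Fin (m + 3)))) :
    chainGlue (K := K) ((v : Fin 3 → V), (w : Fin (m + 2) → V)) ∈ polygonSpace ℓ := by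
  obtain ⟨hv0, hv1, hv2, hvs⟩ := polygonSpace.mem_three v
  obtain ⟨hw0, hw1, hwk, hws⟩ := polygonSpace.mem_succAbove_one w
  rw [mem_polygonSpace_iff]
  refine ⟨fun i => ?_, ?_⟩
  · refine Fin.cases ?_ (fun i => ?_) i
    · exact (ℓ 0).add_mem hv0 hw0
    refine Fin.cases ?_ (fun i => ?_) i
    · rw [Fin.succ_zero_eq_one']; exact hv1
    refine Fin.cases ?_ (fun i => ?_) i
    · rw [Fin.succ_zero_eq_one', Fin.succ_one_eq_two']; exact (ℓ 2).add_mem hv2 hw1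
    · exact hwk i
  · rw [Fin.sum_univ_succ, Fin.sum_univ_succ, Fin.sum_univ_succ]
    simp only [chainGlue_zero, Fin.succ_zero_eq_one', chainGlue_one, Fin.succ_one_eq_two', chainGlue_two,
      chainGlue_succ_succ_succ]
    have e : (v : Fin 3 → V) 0 + (w : Fin (m + 2) → V) 0 + ((v : Fin 3 → V) 1 + ((v : Fin 3 → V) 2 +
        (w : Fin (m + 2) → V) 1 + ∑ k : Fin m, (w : Fin (m + 2) → V) k.succ.succ)) =
        ((v : Fin 3 → V) 0 + (v : Fin 3 → V) 1 + (v : Fin 3 → V) 2) +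
          ((w : Fin (m + 2) → V) 0 + ((w : Fin (m + 2) → V) 1 + ∑ k : Fin m, (w : Fin (m + 2) → V) k.succ.succ)) := by
      abel
    rw [e, hvs, hws, add_zero]

/-- **the gluing map `s : K_{1,2,3} ⊕ K_{1,3,…,n} → K_{1,…,n}`** of [Thomas2006, Prop. 6].
[cite: Thomas2006, §5 Proposition 6 (the map `s`)] -/
def chainGlueK : (polygonSpace ![ℓ 0, ℓ 1, ℓ 2] × polygonSpace (ℓ ∘ Fin.succAbove (1 : Fin (m + 3)))) →ₗ[K]
    polygonSpace ℓ :=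
  LinearMap.codRestrict (polygonSpace ℓ)
    (chainGlue ∘ₗ ((polygonSpace ![ℓ 0, ℓ 1, ℓ 2]).subtype.prodMap
      (polygonSpace (ℓ ∘ Fin.succAbove (1 : Fin (m + 3)))).subtype))
    fun p => chainGlue_mem ℓ p.1 p.2

/-- unfolding. [cite: Thomas2006, §5 Proposition 6] -/
@[simp] theorem coe_chainGlueK (p : polygonSpace ![ℓ 0, ℓ 1, ℓ 2] × polygonSpace (ℓ ∘ Fin.succAbove (1 : Fin (m + 3)))) :
    (chainGlueK ℓ p : Fin (m + 3) → V) = chainGlue (K := K) ((p.1 : Fin 3 → V), (p.2 : Fin (m + 2) → V)) := rfl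

end Chain

/-! ### Lemma 7: `s` is an isometry -/

section Isometry

variable (B : LinearMap.BilinForm K V) {m : ℕ} (ℓ : Fin (m + 3) → Submodule K V)

/-- `Fin.tail` of a `Fin.cons` (plumbing, for `rw`). [folklore] -/
private theorem tail_cons' {α : Type*} {n : ℕ} (a : α) (f : Fin n → α) :
    Fin.tail (Fin.cons a f : Fin (n + 1) → α) = f :=
  rfl

/-- the glued family peeled three times: `q(s(v,w), z)` in terms of the vertices `0, 1, 2` and the rest
(plumbing). [cite: Thomas2006, §5 Lemma 7] -/
theorem polygonBilin_chainGlue_left (p : (Fin 3 → V) × (Fin (m + 2) → V)) (z : Fin (m + 3) → V) :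
    polygonBilin B (m + 3) (chainGlue (K := K) p) z =
      B (p.1 1 + (p.1 2 + p.2 1 + ∑ k : Fin m, p.2 k.succ.succ)) (z 0) +
        (B (p.1 2 + p.2 1 + ∑ k : Fin m, p.2 k.succ.succ) (z 1) +
          (B (∑ k : Fin m, p.2 k.succ.succ) (z 2) +
            polygonBilin B m (fun k : Fin m => p.2 k.succ.succ) (fun k : Fin m => z k.succ.succ.succ))) := by
  have ht : ∀ u : Fin (m + 3) → V, (∑ i : Fin (m + 2), u i.succ) = ∑ i : Fin (m + 2), Fin.tail u i := fun u => rfl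
  rw [polygonBilin_succ, ht, tail_chainGlue, Fin.sum_cons, Fin.sum_cons, polygonBilin_succ, tail_cons']
  have ht' : (∑ i : Fin (m + 1), (Fin.cons (p.1 1) (Fin.cons (p.1 2 + p.2 1) (fun k : Fin m => p.2 k.succ.succ) :
      Fin (m + 1) → V) : Fin (m + 2) → V) i.succ) = p.1 2 + p.2 1 + ∑ k : Fin m, p.2 k.succ.succ := by
    simp only [Fin.cons_succ, Fin.sum_cons]
  rw [ht', polygonBilin_succ, tail_cons']
  have ht'' : (∑ i : Fin m, (Fin.cons (p.1 2 + p.2 1) (fun k : Fin m => p.2 k.succ.succ) : Fin (m + 1) → V) i.succ) =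
      ∑ k : Fin m, p.2 k.succ.succ := by simp only [Fin.cons_succ]
  rw [ht'']
  have hz1 : Fin.tail z 0 = z 1 := by rw [← Fin.succ_zero_eq_one']; rfl
  have hz2 : Fin.tail (Fin.tail z) 0 = z 2 := by rw [← Fin.succ_one_eq_two', ← Fin.succ_zero_eq_one']; rfl
  rw [hz1, hz2]
  rfl

/-- the form of `K(ℓ₀, ℓ₂, ℓ₃, …)` peeled twice (plumbing). [cite: Thomas2006, §5 Lemma 7] -/
private theorem polygonBilin_succAbove (y z : Fin (m + 2) → V) :
    polygonBilin B (m + 2) y z =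
      B (y 1 + ∑ k : Fin m, y k.succ.succ) (z 0) +
        (B (∑ k : Fin m, y k.succ.succ) (z 1) +
          polygonBilin B m (fun k : Fin m => y k.succ.succ) (fun k : Fin m => z k.succ.succ)) := by
  rw [polygonBilin_succ, Fin.sum_univ_succ, Fin.succ_zero_eq_one', polygonBilin_succ]
  have hz1 : Fin.tail z 0 = z 1 := by rw [← Fin.succ_zero_eq_one']; rfl
  rw [hz1]
  rfl

/-- **[Thomas2006, Lemma 7]: the gluing map is an isometry**, `Q_{1,…,n}(s(v, w)) = Q_{1,2,3}(v) + Q_{1,3,…,n}(w)`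
("`s` restricted to each summand is an isometry, and `q(s(v,0), s(0,w)) = 0`"); uses `ℓ₀`, `ℓ₂` isotropic.
[cite: Thomas2006, §5 Lemma 7] -/
theorem polygonForm_chainGlueK (h0 : ∀ x ∈ ℓ 0, ∀ y ∈ ℓ 0, B x y = 0) (h2 : ∀ x ∈ ℓ 2, ∀ y ∈ ℓ 2, B x y = 0)
    (p : polygonSpace ![ℓ 0, ℓ 1, ℓ 2] × polygonSpace (ℓ ∘ Fin.succAbove (1 : Fin (m + 3)))) :
    polygonForm B ℓ (chainGlueK ℓ p) =
      polygonForm B ![ℓ 0, ℓ 1, ℓ 2] p.1 + polygonForm B (ℓ ∘ Fin.succAbove (1 : Fin (m + 3))) p.2 := by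
  obtain ⟨v, w⟩ := p
  obtain ⟨hv0, hv1, hv2, hvs⟩ := polygonSpace.mem_three v
  obtain ⟨hw0, hw1, hwk, hws⟩ := polygonSpace.mem_succAbove_one w
  rw [polygonForm_eq_polygonBilin, polygonForm_eq_polygonBilin, polygonForm_eq_polygonBilin, coe_chainGlueK,
    polygonBilin_chainGlue_left, polygonBilin_three, polygonBilin_succAbove]
  simp only [chainGlue_zero, chainGlue_one, chainGlue_two, chainGlue_succ_succ_succ]
  set x : Fin 3 → V := (v : Fin 3 → V) with hx
  set y : Fin (m + 2) → V := (w : Fin (m + 2) → V) with hy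
  set T : V := ∑ k : Fin m, y k.succ.succ with hT
  -- scalar consequences of `x 0 + x 1 + x 2 = 0`
  have e1 : B (y 1) (x 0) + B (y 1) (x 1) + B (y 1) (x 2) = 0 := by
    rw [← map_add, ← map_add, hvs, map_zero]
  have e2 : B T (x 0) + B T (x 1) + B T (x 2) = 0 := by
    rw [← map_add, ← map_add, hvs, map_zero]
  have e3 : B (x 0) (y 0) + B (x 1) (y 0) + B (x 2) (y 0) = 0 := by
    rw [← LinearMap.add_apply, ← LinearMap.add_apply, ← map_add, ← map_add, hvs, map_zero, LinearMap.zero_apply]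
  have iso1 : B (x 0) (y 0) = 0 := h0 _ hv0 _ hw0
  have iso2 : B (y 1) (x 2) = 0 := h2 _ hw1 _ hv2
  simp only [map_add, LinearMap.add_apply]
  linear_combination e1 + e2 + e3 - iso1 - iso2

/-- Lemma 7 as an identity of quadratic forms: `Q_{1,…,n} ∘ s = Q_{1,2,3} ⊕ Q_{1,3,…,n}`. [cite: Thomas2006, §5 Lemma 7] -/
theorem polygonForm_comp_chainGlueK (h0 : ∀ x ∈ ℓ 0, ∀ y ∈ ℓ 0, B x y = 0) (h2 : ∀ x ∈ ℓ 2, ∀ y ∈ ℓ 2, B x y = 0) :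
    (polygonForm B ℓ).comp (chainGlueK ℓ) =
      (polygonForm B ![ℓ 0, ℓ 1, ℓ 2]).prod (polygonForm B (ℓ ∘ Fin.succAbove (1 : Fin (m + 3)))) :=
  QuadraticMap.ext fun p => by
    rw [QuadraticMap.comp_apply, QuadraticMap.prod_apply, polygonForm_chainGlueK B ℓ h0 h2]

end Isometry

/-! ### Lemma 8: the image of `s` is the orthogonal of the isotropic subspace `s∘r(l₁ ∩ l₃)` -/

section Orthogonal

variable (B : LinearMap.BilinForm K V) {m : ℕ} (ℓ : Fin (m + 3) → Submodule K V)

/-- the family `(−x, 0, x, 0, …, 0)` (the image `s∘r(x)` of [Thomas2006, (seq:longexact)]: `r = (−id, id)` on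
`l₁ ∩ l_k`). [cite: Thomas2006, §5 (seq:longexact), Lemma 8] -/
def chordVec (x : V) : Fin (m + 3) → V :=
  (Fin.cons (-x) (Fin.cons (0 : V) (Fin.cons x (fun _ : Fin m => (0 : V)) : Fin (m + 1) → V) : Fin (m + 2) → V) :
    Fin (m + 3) → V)

/-- `(−x, 0, x, 0, …) = s((−x, 0, x), 0)`. [cite: Thomas2006, §5 Lemma 8] -/
theorem chordVec_eq_chainGlue (x : V) : chordVec (m := m) x = chainGlue (K := K) (![-x, 0, x], (0 : Fin (m + 2) → V)) := by
  ext i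
  refine Fin.cases ?_ (fun i => ?_) i
  · simp [chordVec]
  refine Fin.cases ?_ (fun i => ?_) i
  · simp only [chordVec, Fin.cons_succ, Fin.cons_zero]
    rw [Fin.succ_zero_eq_one', chainGlue_one]; simp
  refine Fin.cases ?_ (fun i => ?_) i
  · simp only [chordVec, Fin.cons_succ, Fin.cons_zero]
    rw [Fin.succ_zero_eq_one', Fin.succ_one_eq_two', chainGlue_two]; simp
  · simp only [chordVec, Fin.cons_succ, chainGlue_succ_succ_succ, Pi.zero_apply]

variable {ℓ}

/-- `(−x, 0, x, 0, …) ∈ K_{1,…,n}` for `x ∈ ℓ₀ ∩ ℓ₂`. [cite: Thomas2006, §5 Lemma 8] -/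
theorem chordVec_mem {x : V} (hx : x ∈ ℓ 0 ⊓ ℓ 2) : chordVec (m := m) x ∈ polygonSpace ℓ := by
  rw [mem_polygonSpace_iff]
  refine ⟨fun i => ?_, ?_⟩
  · refine Fin.cases ?_ (fun i => ?_) i
    · exact (ℓ 0).neg_mem (Submodule.mem_inf.1 hx).1
    refine Fin.cases ?_ (fun i => ?_) i
    · exact Submodule.zero_mem _
    refine Fin.cases ?_ (fun i => ?_) i
    · simp only [chordVec, Fin.cons_succ, Fin.cons_zero]
      rw [Fin.succ_zero_eq_one', Fin.succ_one_eq_two']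
      exact (Submodule.mem_inf.1 hx).2
    · exact Submodule.zero_mem _
  · rw [Fin.sum_univ_succ, Fin.sum_univ_succ, Fin.sum_univ_succ]
    simp only [chordVec, Fin.cons_succ, Fin.cons_zero, Finset.sum_const_zero, add_zero, zero_add, neg_add_cancel]

variable (ℓ)

/-- **the map `s∘r : l₁ ∩ l₃ → K_{1,…,n}`, `x ↦ (−x, 0, x, 0, …)`** (linear). [cite: Thomas2006, §5 Lemma 8] -/
def chordEmbed : ↥(ℓ 0 ⊓ ℓ 2) →ₗ[K] polygonSpace ℓ where
  toFun x := ⟨chordVec (m := m) (x : V), chordVec_mem x.2⟩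
  map_add' x x' := by
    refine Subtype.ext ?_
    simp only [Submodule.coe_add, chordVec_eq_chainGlue (K := K)]
    rw [← map_add, Prod.mk_add_mk, add_zero]
    congr 2
    ext i; fin_cases i <;> simp [add_comm]
  map_smul' c x := by
    refine Subtype.ext ?_
    simp only [Submodule.coe_smul, chordVec_eq_chainGlue (K := K), RingHom.id_apply]
    rw [← map_smul, Prod.smul_mk, smul_zero]
    congr 2
    ext i; fin_cases i <;> simp

/-- unfolding. [cite: Thomas2006, §5 Lemma 8] -/
@[simp] theorem coe_chordEmbed (x : ↥(ℓ 0 ⊓ ℓ 2)) : (chordEmbed ℓ x : Fin (m + 3) → V) = chordVec (m := m) (x : V) := rfl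

/-- **the isotropic subspace `I = s∘r(l₁ ∩ l₃) ⊂ K_{1,…,n}`** of [Thomas2006, Lemma 8]. [cite: Thomas2006, §5 Lemma 8] -/
def chordSubspace : Submodule K (polygonSpace ℓ) :=
  LinearMap.range (chordEmbed ℓ)

/-- `q((−x,0,x,0,…), u) = B(x, u₀) + B(x, u₁)` (peeling). [cite: Thomas2006, §5 Lemma 8 (proof)] -/
theorem polygonBilin_chordVec_left (x : V) (u : Fin (m + 3) → V) :
    polygonBilin B (m + 3) (chordVec (m := m) x) u = B x (u 0) + B x (u 1) := by
  rw [chordVec_eq_chainGlue (K := K), polygonBilin_chainGlue_left]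
  simp only [Matrix.cons_val_zero, Matrix.cons_val_one, Matrix.head_cons, Matrix.cons_val_two, Matrix.tail_cons,
    Pi.zero_apply, add_zero, Finset.sum_const_zero, map_zero, LinearMap.zero_apply, zero_add]
  rw [show (fun _ : Fin m => (0 : V)) = 0 from rfl, map_zero, LinearMap.zero_apply, add_zero]

end Orthogonal

/-! ### Lemma 8 and Proposition 6 -/

section ChainCondition

variable (B : LinearMap.BilinForm K V) {m : ℕ} (ℓ : Fin (m + 3) → Submodule K V)

/-- `q(u, (−x,0,x,0,…)) = −B(Σ_{i≥1} u_i, x) + B(Σ_{i≥3} u_i, x)` (peeling). [cite: Thomas2006, §5 Lemma 8 (proof)] -/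
theorem polygonBilin_chordVec_right (u : Fin (m + 3) → V) (x : V) :
    polygonBilin B (m + 3) u (chordVec (m := m) x) =
      -B (∑ i : Fin (m + 2), u i.succ) x + B (∑ k : Fin m, u k.succ.succ.succ) x := by
  have t0 : ∀ {n : ℕ} (a : V) (f : Fin n → V), Fin.tail (Fin.cons a f : Fin (n + 1) → V) = f := fun _ _ => rfl
  rw [polygonBilin_succ, polygonBilin_succ, polygonBilin_succ]
  simp only [chordVec, Fin.cons_zero, t0, map_neg, map_zero, zero_add]
  rw [show (fun _ : Fin m => (0 : V)) = 0 from rfl, map_zero, add_zero]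
  rfl

variable {B ℓ}

/-- **the polar form of `Q_{1,…,n}` against `s∘r(x)` is `2 B(x, u₁)`** on `K_{1,…,n}` (`B` alternating, `ℓ₀, ℓ₂`
isotropic, `x ∈ ℓ₀ ∩ ℓ₂`): [Thomas2006, Lemma 8, proof] "`q(s∘r(v), w) = Σ_{j=1}^k B(v, w_j)`".
[cite: Thomas2006, §5 Lemma 8] -/
theorem polar_polygonForm_chordEmbed (hB : B.IsAlt) (h0 : ∀ x ∈ ℓ 0, ∀ y ∈ ℓ 0, B x y = 0)
    (h2 : ∀ x ∈ ℓ 2, ∀ y ∈ ℓ 2, B x y = 0) (x : ↥(ℓ 0 ⊓ ℓ 2)) (u : polygonSpace ℓ) :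
    polar (polygonForm B ℓ) (chordEmbed ℓ x) u = 2 * B (x : V) ((u : Fin (m + 3) → V) 1) := by
  have hu := (mem_polygonSpace_iff ℓ (u : Fin (m + 3) → V)).1 u.2
  rw [polar_polygonForm, coe_chordEmbed, polygonBilin_chordVec_left, polygonBilin_chordVec_right]
  set z : Fin (m + 3) → V := (u : Fin (m + 3) → V) with hz
  have hsum : z 0 + (z 1 + (z 2 + ∑ k : Fin m, z k.succ.succ.succ)) = 0 := by
    have e := hu.2
    rw [Fin.sum_univ_succ, Fin.sum_univ_succ, Fin.sum_univ_succ] at e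
    simpa only [Fin.succ_zero_eq_one', Fin.succ_one_eq_two'] using e
  have hS : (∑ i : Fin (m + 2), z i.succ) = z 1 + (z 2 + ∑ k : Fin m, z k.succ.succ.succ) := by
    rw [Fin.sum_univ_succ, Fin.sum_univ_succ]
    simp only [Fin.succ_zero_eq_one', Fin.succ_one_eq_two']
  rw [hS]
  have hx0 : (x : V) ∈ ℓ 0 := (Submodule.mem_inf.1 x.2).1
  have hx2 : (x : V) ∈ ℓ 2 := (Submodule.mem_inf.1 x.2).2
  have i0 : B (x : V) (z 0) = 0 := h0 _ hx0 _ (hu.1 0)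
  have i2 : B (z 2) (x : V) = 0 := h2 _ (hu.1 2) _ hx2
  have a1 : -B (z 1) (x : V) = B (x : V) (z 1) := LinearMap.IsAlt.neg hB _ _
  simp only [map_add, LinearMap.add_apply]
  linear_combination i0 - i2 + a1

/-- **`I = s∘r(l₁ ∩ l₃)` is totally isotropic** (`Q(−x,0,x,0,…) = −B(x,x) = 0`). [cite: Thomas2006, §5 Lemma 8] -/
theorem isTotallyIsotropic_chordSubspace (hB : B.IsAlt) :
    IsTotallyIsotropic (polygonForm B ℓ) (chordSubspace ℓ) := by
  rintro _ ⟨x, rfl⟩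
  rw [polygonForm_eq_polygonBilin, coe_chordEmbed, polygonBilin_chordVec_left]
  have t1 : chordVec (m := m) (x : V) 1 = 0 := by
    rw [← Fin.succ_zero_eq_one']; rfl
  simp only [chordVec, Fin.cons_zero, map_neg, hB (x : V), neg_zero, zero_add]
  rw [← Fin.succ_zero_eq_one']
  change B (x : V) ((Fin.cons (0 : V) (Fin.cons (x : V) (fun _ : Fin m => (0 : V)) : Fin (m + 1) → V) :
    Fin (m + 2) → V) 0) = 0
  rw [Fin.cons_zero, map_zero]

variable [NeZero (2 : K)] [FiniteDimensional K V]

/-- **[Thomas2006, Lemma 8]: "The image of `s` is exactly `(image s∘r)^⊥`"** inside `K_{1,…,n}` (`B` symplectic,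
`ℓ₀, ℓ₂` Lagrangian, characteristic `≠ 2`): `u ∈ (s∘r(l₁ ∩ l₃))^⊥ ⟺ u₁ ∈ (l₁ ∩ l₃)^⊥ = l₁ + l₃ ⟺ u ∈ image s`.
[cite: Thomas2006, §5 Lemma 8] -/
theorem range_chainGlueK_eq (hB : B.IsAlt) (hN : B.Nondegenerate) (h0 : B.orthogonal (ℓ 0) = ℓ 0)
    (h2 : B.orthogonal (ℓ 2) = ℓ 2) :
    LinearMap.range (chainGlueK ℓ) = (polarForm (polygonForm B ℓ)).orthogonal (chordSubspace ℓ) := by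
  have iso0 := isotropic_of_orthogonal_eq_self h0
  have iso2 := isotropic_of_orthogonal_eq_self h2
  refine le_antisymm ?_ ?_
  · rintro _ ⟨⟨v, w⟩, rfl⟩
    refine LinearMap.BilinForm.mem_orthogonal_iff.2 ?_
    rintro _ ⟨x, rfl⟩
    change polar (polygonForm B ℓ) (chordEmbed ℓ x) (chainGlueK ℓ (v, w)) = 0
    rw [polar_polygonForm_chordEmbed hB iso0 iso2, coe_chainGlueK, chainGlue_one]
    obtain ⟨hv0, hv1, hv2, hvs⟩ := polygonSpace.mem_three v
    have e : B (x : V) ((v : Fin 3 → V) 0) + B (x : V) ((v : Fin 3 → V) 1) + B (x : V) ((v : Fin 3 → V) 2) = 0 := by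
      rw [← map_add, ← map_add, hvs, map_zero]
    have i0 : B (x : V) ((v : Fin 3 → V) 0) = 0 := iso0 _ (Submodule.mem_inf.1 x.2).1 _ hv0
    have i2 : B (x : V) ((v : Fin 3 → V) 2) = 0 := iso2 _ (Submodule.mem_inf.1 x.2).2 _ hv2
    linear_combination 2 * e - 2 * i0 - 2 * i2
  · intro u hu
    have hu' := (mem_polygonSpace_iff ℓ (u : Fin (m + 3) → V)).1 u.2
    set z : Fin (m + 3) → V := (u : Fin (m + 3) → V) with hz
    -- `z 1 ∈ (ℓ 0 ⊓ ℓ 2)^⊥ = ℓ 0 + ℓ 2`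
    have h1 : z 1 ∈ B.orthogonal (ℓ 0 ⊓ ℓ 2) := by
      refine LinearMap.BilinForm.mem_orthogonal_iff.2 fun x hx => ?_
      have e := LinearMap.BilinForm.mem_orthogonal_iff.1 hu (chordEmbed ℓ ⟨x, hx⟩) ⟨⟨x, hx⟩, rfl⟩
      change polar (polygonForm B ℓ) (chordEmbed ℓ ⟨x, hx⟩) u = 0 at e
      rw [polar_polygonForm_chordEmbed hB iso0 iso2] at e
      exact (mul_eq_zero.1 e).resolve_left two_ne_zero
    rw [orthogonal_inf_eq_sup hN (LinearMap.IsAlt.isRefl hB), h0, h2] at h1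
    obtain ⟨a, ha, c, hc, hac⟩ := Submodule.mem_sup.1 h1
    have hsum : z 0 + (z 1 + (z 2 + ∑ k : Fin m, z k.succ.succ.succ)) = 0 := by
      have e := hu'.2
      rw [Fin.sum_univ_succ, Fin.sum_univ_succ, Fin.sum_univ_succ] at e
      simpa only [Fin.succ_zero_eq_one', Fin.succ_one_eq_two'] using e
    -- the preimage
    have hvmem : (![-a, z 1, -c] : Fin 3 → V) ∈ polygonSpace ![ℓ 0, ℓ 1, ℓ 2] := by
      rw [mem_polygonSpace_iff]
      refine ⟨fun i => ?_, ?_⟩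
      · fin_cases i
        · simpa using (ℓ 0).neg_mem ha
        · simpa using hu'.1 1
        · simpa using (ℓ 2).neg_mem hc
      · rw [Fin.sum_univ_three]
        simp only [Matrix.cons_val_zero, Matrix.cons_val_one, Matrix.cons_val_two, Matrix.head_cons,
          Matrix.tail_cons, ← hac]
        abel
    have hwmem : (Fin.cons (z 0 + a) (Fin.cons (z 2 + c) (fun k : Fin m => z k.succ.succ.succ) : Fin (m + 1) → V) :
        Fin (m + 2) → V) ∈ polygonSpace (ℓ ∘ Fin.succAbove (1 : Fin (m + 3))) := by
      rw [mem_polygonSpace_iff]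
      refine ⟨fun i => ?_, ?_⟩
      · refine Fin.cases ?_ (fun i => ?_) i
        · rw [Fin.cons_zero, Function.comp_apply, Fin.one_succAbove_zero]
          exact (ℓ 0).add_mem (hu'.1 0) ha
        refine Fin.cases ?_ (fun i => ?_) i
        · rw [Fin.cons_succ, Fin.cons_zero, Function.comp_apply, Fin.one_succAbove_succ, Fin.succ_zero_eq_one',
            Fin.succ_one_eq_two']
          exact (ℓ 2).add_mem (hu'.1 2) hc
        · rw [Fin.cons_succ, Fin.cons_succ, Function.comp_apply, Fin.one_succAbove_succ]
          exact hu'.1 _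
      · rw [Fin.sum_cons, Fin.sum_cons]
        have e : z 0 + a + (z 2 + c + ∑ k : Fin m, z k.succ.succ.succ) =
            (z 0 + (z 1 + (z 2 + ∑ k : Fin m, z k.succ.succ.succ))) + (a + c - z 1) := by abel
        rw [e, hsum, hac, sub_self, add_zero]
    refine ⟨(⟨_, hvmem⟩, ⟨_, hwmem⟩), Subtype.ext ?_⟩
    rw [coe_chainGlueK]
    ext i
    refine Fin.cases ?_ (fun i => ?_) i
    · rw [chainGlue_zero]
      simp only [Matrix.cons_val_zero, Fin.cons_zero]
      change -a + (z 0 + a) = z 0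
      abel
    refine Fin.cases ?_ (fun i => ?_) i
    · rw [Fin.succ_zero_eq_one', chainGlue_one]
      simp only [Matrix.cons_val_one]
      rfl
    refine Fin.cases ?_ (fun i => ?_) i
    · rw [Fin.succ_zero_eq_one', Fin.succ_one_eq_two', chainGlue_two]
      simp only [Matrix.cons_val_two, Matrix.tail_cons, Matrix.head_cons, Fin.cons_one, Fin.cons_zero]
      change -c + (z 2 + c) = z 2
      abel
    · rw [chainGlue_succ_succ_succ]
      simp only [Fin.cons_succ]
      rfl

/-- **[Thomas2006, Proposition 6] (chain condition) for the chord `(l₁, l₃)`: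
`τ(l₁, l₂, …, lₙ) = τ(l₁, l₂, l₃) + τ(l₁, l₃, …, lₙ)`** in `W(K)` — `T_{1,2,3} ⊕ T_{1,3,…,n}` is a quadratic
subquotient of `T_{1,…,n}` (Lemmas 7, 8) "therefore, by Lemma 1, `τ_{1,2,3} + τ_{1,3,…,n} = τ_{1,2,…,n}`". Here
`ℓ : Fin (m+3) → _`, the triangle is `![ℓ 0, ℓ 1, ℓ 2]`, the rest is `ℓ ∘ Fin.succAbove 1`; hypotheses: `B` symplectic,
`ℓ₀, ℓ₂` Lagrangian, characteristic `≠ 2` (the other `ℓᵢ` arbitrary). [cite: Thomas2006, §5 Proposition 6] -/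
theorem polygonWittIndex_chain₃ (hB : B.IsAlt) (hN : B.Nondegenerate) (h0 : B.orthogonal (ℓ 0) = ℓ 0)
    (h2 : B.orthogonal (ℓ 2) = ℓ 2) :
    polygonWittIndex B ℓ =
      polygonWittIndex B ![ℓ 0, ℓ 1, ℓ 2] + polygonWittIndex B (ℓ ∘ Fin.succAbove (1 : Fin (m + 3))) := by
  rw [polygonWittIndex_eq, polygonWittIndex_eq, polygonWittIndex_eq, ← wittClass_prod]
  exact (wittClass_eq_of_range_eq_orthogonal (polygonForm B ℓ) (isTotallyIsotropic_chordSubspace hB) _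
    (chainGlueK ℓ) (range_chainGlueK_eq hB hN h0 h2)
    (polygonForm_comp_chainGlueK B ℓ (isotropic_of_orthogonal_eq_self h0) (isotropic_of_orthogonal_eq_self h2)).symm).symm

/-- **chain condition in Kashiwara's terms**: `τ(ℓ₀, ℓ₁, …) = τ_K(ℓ₀, ℓ₁, ℓ₂) + τ(ℓ₀, ℓ₂, ℓ₃, …)` (Prop. 6 with
Prop. 11). [cite: Thomas2006, §5 Proposition 6; §7 Proposition 11] -/
theorem polygonWittIndex_chain₃_kashiwara (hB : B.IsAlt) (hN : B.Nondegenerate) (h0 : B.orthogonal (ℓ 0) = ℓ 0)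
    (h2 : B.orthogonal (ℓ 2) = ℓ 2) :
    polygonWittIndex B ℓ =
      kashiwaraWittIndex B (ℓ 0) (ℓ 1) (ℓ 2) + polygonWittIndex B (ℓ ∘ Fin.succAbove (1 : Fin (m + 3))) := by
  rw [polygonWittIndex_chain₃ hB hN h0 h2, polygonWittIndex_three_eq_kashiwaraWittIndex hB h0]

/-- **the fan formula `τ(l₁, …, lₙ) = Σ_{j=2}^{n−1} τ_K(l₁, l_j, l_{j+1})`** for Lagrangians `lᵢ` of a symplectic
space (characteristic `≠ 2`) — Kashiwara's inductive definition (Kash:cocycle2) recovered from the quadratic space,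
[Thomas2006, Prop. 11] for all `n`; the `W(K)`-version of [LionVergne1980, 1.5.12].
[cite: Thomas2006, §7 Proposition 11 and (Kash:cocycle2); LionVergne1980, §1.5.12] -/
theorem polygonWittIndex_eq_sum_kashiwaraWittIndex (hB : B.IsAlt) (hN : B.Nondegenerate) :
    ∀ {m : ℕ} (ℓ : Fin (m + 3) → Submodule K V), (∀ i, B.orthogonal (ℓ i) = ℓ i) →
      polygonWittIndex B ℓ =
        ∑ j : Fin (m + 1), kashiwaraWittIndex B (ℓ 0) (ℓ j.succ.castSucc) (ℓ j.succ.succ) := by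
  intro m
  induction m with
  | zero =>
    intro ℓ hℓ
    rw [polygonWittIndex_chain₃_kashiwara hB hN (hℓ 0) (hℓ 2),
      polygonWittIndex_eq_zero_of_le_two B _ hB (le_refl 2), add_zero, Fin.sum_univ_one]
    rfl
  | succ m ih =>
    intro ℓ hℓ
    rw [polygonWittIndex_chain₃_kashiwara hB hN (hℓ 0) (hℓ 2), ih (ℓ ∘ Fin.succAbove (1 : Fin (m + 4)))
      (fun i => hℓ _)]
    rw [Fin.sum_univ_succ (f := fun j : Fin (m + 2) =>
      kashiwaraWittIndex B (ℓ 0) (ℓ j.succ.castSucc) (ℓ j.succ.succ))]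
    -- both summands agree definitionally (`(1 : Fin _).succAbove` computes on `0` and on successors)
    congr 1

end ChainCondition

end Literature.LinearAlgebra.QuadraticForm
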